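import Summits.CriticalPhenomena.PercolationContinuityZ3.Theorems.PercNearOneGluingNoHeavyLowerTailAntitheticEarBoxKit
import HarnessLib

/-!
# `NoHeavyLowerTail` (stmt-CriticalPhenomena-4575) — antithetic cluster pairs: RED DOMINATION of the cycle + ear boxes, P inside the span
# (THEOREM Θ², HOME/MEMO-gen63.md §3; prim-hp-2 gen 63)

Support file (`--supports stmt-CriticalPhenomena-4575`, hull-port prover `prim-hp-2`, gen 63).  No definitions, no named facts, no sorries;
standard axioms.  Setting of …AntitheticEarTools / …EarBoxKit / …EarSpanBoxes: cycle `v`, ear `u 0 = v α, …, u ℓ = v β`,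
`E = Cyc.edgeSet n v ∪ Cyc.edgeSet ℓ u`, `P = v p` with `α < p < β`; boxes described by index data `(rd, bl, er)` with any sets `Fix, N`
having the described memberships.  The three families with a fixed-blue pair are red-dominated (`Y T' ⊆ X T` for members opposite off
`Fix`), by the index-level shielding criterion `Cyc.dbox_dom`: every fixed-blue pair is entered by the blue cluster only from its free side
and lands in the red core; the component of its red end in the shielding graph is a single vertex (plus the free ear hanging at it, for
a CELL whose red end is `v α`).
* `Cyc.dom_span_cell` — CELL `k` (`k < p`): `edge v k` blue, `(k,n)` red, ear free;
* `Cyc.dom_span_FA` — FA `j k`: ear red, `[0,α) ∪ (j,k)` red, `edge v j`, `edge v k` blue;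
* `Cyc.dom_span_FB` — FB `j k`: ear red, `(k,j) ∪ [β,n)` red, `edge v j`, `edge v k` blue.
Machine check of the scheme: lab/cycle_ear_scheme.py (all `n ≤ 9`: exact domination).
[cite: VandenbergHaggstromKahn2005, §1 p. 3 (open cluster `C_s`)]
-/

noncomputable section

namespace Summit.CriticalPhenomena.PercolationContinuityZ3.Theorems

open Literature.Probability.Percolation
open scoped Classical

namespace Antithetic

namespace Cyc

variable {V : Type*} {n : ℕ} {v : ℕ → V} {ℓ : ℕ} {u : ℕ → V} {α β p : ℕ}
  (rd bl : ℕ → Prop) (er : Prop) (Fix N : Set (Sym2 V))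
  (hFix : ∀ e, e ∈ Fix ↔ (∃ i, i < n ∧ (rd i ∨ bl i) ∧ e = edge v i) ∨ (er ∧ ∃ m, m < ℓ ∧ e = edge u m))
  (hN : ∀ e, e ∈ N ↔ (∃ i, i < n ∧ rd i ∧ e = edge v i) ∨ (er ∧ ∃ m, m < ℓ ∧ e = edge u m))

include hFix hN in
/-- A run of fixed-red cycle pairs `[a,b)` joins `v a` to `v b` in the red core graph. [this work] -/
theorem dbox_core_reach {a b : ℕ} (hab : a ≤ b) (hbn : b ≤ n) (h : ∀ i, a ≤ i → i < b → rd i) :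
    (openGraph (N ∩ Fix ∩ (edgeSet n v ∪ edgeSet ℓ u))).Reachable (v a) (v b) :=
  reach_chain _ v hab fun i hai hib => dbox_core_mem_v rd bl er Fix N hFix hN (by omega) (h i hai hib)

include hFix hN in
/-- A fixed-red ear joins its ends in the red core graph. [this work] -/
theorem dbox_core_reach_ear (he : er) : (openGraph (N ∩ Fix ∩ (edgeSet n v ∪ edgeSet ℓ u))).Reachable (u 0) (u ℓ) :=
  reach_chain _ u (Nat.zero_le ℓ) fun _ _ hm => dbox_core_mem_u rd bl er Fix N hFix hN he hm

variable (hn : 3 ≤ n) (hinj : ∀ i j, i < n → j < n → v i = v j → i = j) (hper : v n = v 0) (hℓ : 1 ≤ ℓ)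
  (hαp : α < p) (hpβ : p < β) (hβn : β < n) (hu0 : u 0 = v α) (huℓ : u ℓ = v β)
  (hfresh : ∀ j, 0 < j → j < ℓ → ∀ i, i ≤ n → u j ≠ v i) (huinj : ∀ i j, i ≤ ℓ → j ≤ ℓ → u i = u j → i = j)
  (hRC : ∀ m, m < ℓ → ∀ i, i < n → edge u m ≠ edge v i)
include hFix hN hn hinj hper hℓ hαp hpβ hβn hu0 huℓ hfresh huinj hRC

/-- **CELL `k` is red-dominated** (`k < p`: `edge v k` blue, `(k,n)` red, the rest — `[0,k)` and the ear — free). [this work] -/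
theorem dom_span_cell {k : ℕ} (hkp : k < p) (hrd : ∀ i, rd i ↔ k < i) (hbl : ∀ i, bl i ↔ i = k)
    {T T' : Set (Sym2 V)} (hT : ∀ e ∈ Fix, (e ∈ T ↔ e ∈ N)) (hT' : ∀ e ∈ Fix, (e ∈ T' ↔ e ∈ N))
    (hflip : ∀ e ∉ Fix, (e ∈ T' ↔ e ∉ T)) :
    openCluster (T'ᶜ ∩ (edgeSet n v ∪ edgeSet ℓ u)) (v 0) ⊆ openCluster (T ∩ (edgeSet n v ∪ edgeSet ℓ u)) (v 0) := by
  refine dbox_dom hn hinj hper hRC rd bl er Fix N hFix hN (fun k' hk'n hblk' => ?_) hT hT' hflip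
  obtain rfl : k' = k := (hbl k').1 hblk'
  constructor
  · -- `v (k+1)` lies in the red core: the arc `(k, n)` back to `s = v n`
    left
    have h := dbox_core_reach rd bl er Fix N hFix hN (by omega : k' + 1 ≤ n) le_rfl fun i hi hin => (hrd i).2 (by omega)
    rw [hper] at h
    exact h.symm
  · by_cases hk0 : k' = 0
    · left; rw [hk0]; exact mem_openCluster_self _ _
    right
    -- the component of `v (k+1)` in the shielding graph of `v k`: itself, plus the free ear if it hangs at `v (k+1) = v α`
    refine not_mem_cluster_of_closed _ (v 0) (v (k' + 1))
      ({x | ∃ i, i ≤ n ∧ (i = k' + 1 ∨ (α = k' + 1 ∧ i = β)) ∧ x = v i} ∪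
        {x | ∃ j, 0 < j ∧ j < ℓ ∧ (α = k' + 1) ∧ x = u j}) ?_ ?_ ?_
    · exact (mem_idxSet_v hinj hper hn hfresh _ _ (by omega) (by omega)).2 (Or.inl rfl)
    · exact fun h => absurd ((mem_idxSet_v hinj hper hn hfresh _ _ (by omega) (Nat.zero_le n)).1 h) (by omega)
    · refine ear_closed_of_idx hn hinj hper hℓ (by omega) hβn hu0 huℓ hfresh huinj _ (fun e he => he.1) _ _ (by omega)
        (fun i hin => ?_) (fun _ _ _ => Or.inl Iff.rfl) (fun _ => Or.inl (by omega)) (fun _ => Or.inl (by omega))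
        (fun _ => Or.inl (by omega))
      by_cases hki : k' < i
      · exact Or.inr (dbox_notG_red rd bl er Fix N hFix hN _ hin ((hrd i).2 hki))
      by_cases hik : i = k'
      · exact Or.inr (hik ▸ dbox_notG_touch Fix N _ (Or.inl rfl))
      · exact Or.inl (by omega)

/-- **FA `j k` is red-dominated** (ear red, `[0,α) ∪ (j,k)` red, `edge v j`, `edge v k` blue; `α ≤ j < p < β ≤ k < n`). [this work] -/
theorem dom_span_FA {j k : ℕ} (hαj : α ≤ j) (hjp : j < p) (hβk : β ≤ k) (hkn : k < n)
    (hrd : ∀ i, rd i ↔ (i < α ∨ (j < i ∧ i < k))) (hbl : ∀ i, bl i ↔ (i = j ∨ i = k)) (her : er)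
    {T T' : Set (Sym2 V)} (hT : ∀ e ∈ Fix, (e ∈ T ↔ e ∈ N)) (hT' : ∀ e ∈ Fix, (e ∈ T' ↔ e ∈ N))
    (hflip : ∀ e ∉ Fix, (e ∈ T' ↔ e ∉ T)) :
    openCluster (T'ᶜ ∩ (edgeSet n v ∪ edgeSet ℓ u)) (v 0) ⊆ openCluster (T ∩ (edgeSet n v ∪ edgeSet ℓ u)) (v 0) := by
  -- the red core contains `v α`, `v β`, and the runs `(j, β]`, `[β, k]`
  have hα : v α ∈ openCluster (N ∩ Fix ∩ (edgeSet n v ∪ edgeSet ℓ u)) (v 0) :=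
    dbox_core_reach rd bl er Fix N hFix hN (Nat.zero_le α) (by omega) fun i _ hi => (hrd i).2 (Or.inl hi)
  have hβ : v β ∈ openCluster (N ∩ Fix ∩ (edgeSet n v ∪ edgeSet ℓ u)) (v 0) := by
    have h := dbox_core_reach_ear rd bl er Fix N hFix hN her
    rw [hu0, huℓ] at h
    exact hα.trans h
  refine dbox_dom hn hinj hper hRC rd bl er Fix N hFix hN (fun k' hk'n hblk' => ?_) hT hT' hflip
  rcases (hbl k').1 hblk' with rfl | rfl
  · -- the blue pair `j`: red end `v (j+1)` (towards `P` and `v β`), free end `v j` (unless `j = α`)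
    constructor
    · left
      have h := dbox_core_reach rd bl er Fix N hFix hN (by omega : k' + 1 ≤ β) hβn.le
        fun i hi hiβ => (hrd i).2 (Or.inr ⟨by omega, by omega⟩)
      exact hβ.trans h.symm
    · by_cases hjα : k' = α
      · left; rw [hjα]; exact hα
      right
      refine not_mem_cluster_of_closed _ (v 0) (v (k' + 1))
        ({x | ∃ i, i ≤ n ∧ i = k' + 1 ∧ x = v i} ∪ {x | ∃ j, 0 < j ∧ j < ℓ ∧ False ∧ x = u j}) ?_ ?_ ?_
      · exact (mem_idxSet_v hinj hper hn hfresh _ (fun _ => False) (by omega) (by omega)).2 rfl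
      · exact fun h => absurd ((mem_idxSet_v hinj hper hn hfresh _ (fun _ => False) (by omega) (Nat.zero_le n)).1 h) (by omega)
      · refine ear_closed_of_idx hn hinj hper hℓ (by omega) hβn hu0 huℓ hfresh huinj _ (fun e he => he.1) _ _ (by omega)
          (fun i hin => ?_) (fun _ _ _ => Or.inl Iff.rfl) (fun _ => Or.inl (iff_of_false (by omega) not_false))
          (fun _ => Or.inl (iff_of_false not_false (by omega))) (fun _ => Or.inl (iff_of_false (by omega) (by omega)))
        by_cases h1 : i = k'
        · exact Or.inr (h1 ▸ dbox_notG_touch Fix N _ (Or.inl rfl))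
        by_cases h2 : i = k' + 1
        · exact Or.inr (h2 ▸ dbox_notG_red rd bl er Fix N hFix hN _ (by omega) ((hrd _).2 (Or.inr ⟨by omega, by omega⟩)))
        · exact Or.inl (by omega)
  · -- the blue pair `k`: red end `v k` (towards `v β`), free end `v (k+1)` (unless it is `s = v n`)
    constructor
    · by_cases hkn1 : k' + 1 = n
      · left; rw [hkn1, hper]; exact mem_openCluster_self _ _
      right
      refine not_mem_cluster_of_closed _ (v 0) (v k')
        ({x | ∃ i, i ≤ n ∧ i = k' ∧ x = v i} ∪ {x | ∃ j, 0 < j ∧ j < ℓ ∧ False ∧ x = u j}) ?_ ?_ ?_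
      · exact (mem_idxSet_v hinj hper hn hfresh _ (fun _ => False) (by omega) (by omega)).2 rfl
      · exact fun h => absurd ((mem_idxSet_v hinj hper hn hfresh _ (fun _ => False) (by omega) (Nat.zero_le n)).1 h) (by omega)
      · refine ear_closed_of_idx hn hinj hper hℓ (by omega) hβn hu0 huℓ hfresh huinj _ (fun e he => he.1) _ _ (by omega)
          (fun i hin => ?_) (fun _ _ _ => Or.inl Iff.rfl)
          (fun hℓ2 => Or.inr (dbox_notG_ear rd bl er Fix N hFix hN _ her (by omega)))
          (fun hℓ2 => Or.inr (dbox_notG_ear rd bl er Fix N hFix hN _ her (by omega)))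
          (fun hℓ1 => Or.inr (dbox_notG_ear rd bl er Fix N hFix hN _ her (by omega)))
        by_cases h1 : i = k'
        · exact Or.inr (h1 ▸ dbox_notG_touch Fix N _ (Or.inr rfl))
        by_cases h2 : i + 1 = k'
        · exact Or.inr (dbox_notG_red rd bl er Fix N hFix hN _ hin ((hrd _).2 (Or.inr ⟨by omega, by omega⟩)))
        · exact Or.inl (by omega)
    · left
      have h := dbox_core_reach rd bl er Fix N hFix hN hβk hkn.le fun i hβi hik => (hrd i).2 (Or.inr ⟨by omega, hik⟩)
      exact hβ.trans h

/-- **FB `j k` is red-dominated** (ear red, `(k,j) ∪ [β,n)` red, `edge v j`, `edge v k` blue; `k < α < p ≤ j < β`). [this work] -/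
theorem dom_span_FB {j k : ℕ} (hpj : p ≤ j) (hjβ : j < β) (hkα : k < α)
    (hrd : ∀ i, rd i ↔ ((k < i ∧ i < j) ∨ β ≤ i)) (hbl : ∀ i, bl i ↔ (i = j ∨ i = k)) (her : er)
    {T T' : Set (Sym2 V)} (hT : ∀ e ∈ Fix, (e ∈ T ↔ e ∈ N)) (hT' : ∀ e ∈ Fix, (e ∈ T' ↔ e ∈ N))
    (hflip : ∀ e ∉ Fix, (e ∈ T' ↔ e ∉ T)) :
    openCluster (T'ᶜ ∩ (edgeSet n v ∪ edgeSet ℓ u)) (v 0) ⊆ openCluster (T ∩ (edgeSet n v ∪ edgeSet ℓ u)) (v 0) := by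
  -- the red core contains `v β` (arc `[β,n)` back to `s`), `v α` (ear), and the run `(k, j]`
  have hβ : v β ∈ openCluster (N ∩ Fix ∩ (edgeSet n v ∪ edgeSet ℓ u)) (v 0) := by
    have h := dbox_core_reach rd bl er Fix N hFix hN hβn.le le_rfl fun i hβi _ => (hrd i).2 (Or.inr hβi)
    rw [hper] at h
    exact h.symm
  have hα : v α ∈ openCluster (N ∩ Fix ∩ (edgeSet n v ∪ edgeSet ℓ u)) (v 0) := by
    have h := dbox_core_reach_ear rd bl er Fix N hFix hN her
    rw [hu0, huℓ] at h
    exact hβ.trans h.symm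
  refine dbox_dom hn hinj hper hRC rd bl er Fix N hFix hN (fun k' hk'n hblk' => ?_) hT hT' hflip
  rcases (hbl k').1 hblk' with rfl | rfl
  · -- the blue pair `j`: red end `v j` (towards `v α`), free end `v (j+1)` (unless `j + 1 = β`)
    constructor
    · by_cases hjβ1 : k' + 1 = β
      · left; rw [hjβ1]; exact hβ
      right
      refine not_mem_cluster_of_closed _ (v 0) (v k')
        ({x | ∃ i, i ≤ n ∧ i = k' ∧ x = v i} ∪ {x | ∃ j, 0 < j ∧ j < ℓ ∧ False ∧ x = u j}) ?_ ?_ ?_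
      · exact (mem_idxSet_v hinj hper hn hfresh _ (fun _ => False) (by omega) (by omega)).2 rfl
      · exact fun h => absurd ((mem_idxSet_v hinj hper hn hfresh _ (fun _ => False) (by omega) (Nat.zero_le n)).1 h) (by omega)
      · refine ear_closed_of_idx hn hinj hper hℓ (by omega) hβn hu0 huℓ hfresh huinj _ (fun e he => he.1) _ _ (by omega)
          (fun i hin => ?_) (fun _ _ _ => Or.inl Iff.rfl) (fun _ => Or.inl (iff_of_false (by omega) not_false))
          (fun _ => Or.inl (iff_of_false not_false (by omega))) (fun _ => Or.inl (iff_of_false (by omega) (by omega)))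
        by_cases h1 : i = k'
        · exact Or.inr (h1 ▸ dbox_notG_touch Fix N _ (Or.inr rfl))
        by_cases h2 : i + 1 = k'
        · exact Or.inr (dbox_notG_red rd bl er Fix N hFix hN _ hin ((hrd _).2 (Or.inl ⟨by omega, by omega⟩)))
        · exact Or.inl (by omega)
    · left
      have h := dbox_core_reach rd bl er Fix N hFix hN (by omega : α ≤ k') (by omega)
        fun i hαi hik => (hrd i).2 (Or.inl ⟨by omega, hik⟩)
      exact hα.trans h
  · -- the blue pair `k`: red end `v (k+1)` (towards `v α`), free end `v k` (unless `k = 0`)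
    constructor
    · left
      have h := dbox_core_reach rd bl er Fix N hFix hN (by omega : k' + 1 ≤ α) (by omega)
        fun i hi hiα => (hrd i).2 (Or.inl ⟨by omega, by omega⟩)
      exact hα.trans h.symm
    · by_cases hk0 : k' = 0
      · left; rw [hk0]; exact mem_openCluster_self _ _
      right
      refine not_mem_cluster_of_closed _ (v 0) (v (k' + 1))
        ({x | ∃ i, i ≤ n ∧ i = k' + 1 ∧ x = v i} ∪ {x | ∃ j, 0 < j ∧ j < ℓ ∧ False ∧ x = u j}) ?_ ?_ ?_
      · exact (mem_idxSet_v hinj hper hn hfresh _ (fun _ => False) (by omega) (by omega)).2 rfl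
      · exact fun h => absurd ((mem_idxSet_v hinj hper hn hfresh _ (fun _ => False) (by omega) (Nat.zero_le n)).1 h) (by omega)
      · refine ear_closed_of_idx hn hinj hper hℓ (by omega) hβn hu0 huℓ hfresh huinj _ (fun e he => he.1) _ _ (by omega)
          (fun i hin => ?_) (fun _ _ _ => Or.inl Iff.rfl)
          (fun hℓ2 => Or.inr (dbox_notG_ear rd bl er Fix N hFix hN _ her (by omega)))
          (fun hℓ2 => Or.inr (dbox_notG_ear rd bl er Fix N hFix hN _ her (by omega)))
          (fun hℓ1 => Or.inr (dbox_notG_ear rd bl er Fix N hFix hN _ her (by omega)))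
        by_cases h1 : i = k'
        · exact Or.inr (h1 ▸ dbox_notG_touch Fix N _ (Or.inl rfl))
        by_cases h2 : i = k' + 1
        · exact Or.inr (h2 ▸ dbox_notG_red rd bl er Fix N hFix hN _ (by omega) ((hrd _).2 (Or.inl ⟨by omega, by omega⟩)))
        · exact Or.inl (by omega)

end Cyc

end Antithetic

end Summit.CriticalPhenomena.PercolationContinuityZ3.Theorems
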